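import Summits.QuantumAdvantage.QuantumAdvantage.Theorems.MobiusLadderLiouvilleNotPPolyTwinKernel
import Summits.QuantumAdvantage.QuantumAdvantage.Theorems.MobiusLadderLiouvilleNotPPolyStubJacobiSymCodeFP
import Summits.QuantumAdvantage.QuantumAdvantage.Theorems.MobiusLadderLiouvilleNotPPolyStubTwoAdicSplitCodeFP
import Summits.QuantumAdvantage.QuantumAdvantage.Theorems.MobiusLadderLiouvilleNotPPolyStubTwinsRefute
import Summits.QuantumAdvantage.QuantumAdvantage.Theorems.MobiusLadderLiouvilleNotPPolyStubTwinDivisorSum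
import Summits.QuantumAdvantage.QuantumAdvantage.Theorems.MobiusLadderLiouvilleNotPPolyStubDivisorSumHyperbola
import Summits.QuantumAdvantage.QuantumAdvantage.Theorems.MobiusLadderLiouvilleNotPPolyStubTwinFreeSublinear

/-!
# The arithmetic debt of the crux `MobiusLadder.LiouvilleNotPPoly` (stmt-QuantumAdvantage-1389):
# Liouville twins refute it, and twins are large

Helper file (continuation lead c2, line `Sketch`, idea `twin-exclusion-rigidity`), assembling the
by-product stubs T1a–c and T2a–c of the line (all ACCEPTED tree theorems) into the two statements
the line was built to earn:

* `not_liouvilleNotPPoly_of_eventualPolyTwins` (T1) — if for some `k` every large level `2^n` has a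
  *Liouville twin* `d` (`(d | p) = −1` for all odd primes `p ≤ 2^n`) with `|d| ≤ 2^{n^k}`, then
  `L_λ ∈ P/poly` (Jacobi's algorithm on the advice `d_n`), i.e. the crux FAILS; contrapositively,
  `exists_nonInert_prime_of_liouvilleNotPPoly`: ANY proof of the crux proves, for every `k` and
  infinitely many `n`, that every `|d| ≤ 2^{n^k}` has an odd prime `p ≤ 2^n` with `(d | p) ≠ −1` — a
  least-non-inert-prime bound of strength `exp((log |d|)^{1/k})`, beyond Vinogradov's conjecture
  on prime quadratic residues and unproved (GRH-true);
* `not_twin_of_abs_le_rpow` (T2) — unconditionally, for every `c < 1` and all large `n`, NO `d`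
  with `|d| ≤ 2^{cn}` is a twin of level `2^n` (Dirichlet's hyperbola method for the divisor sums of
  the Kronecker character `χ_d`, the trivial character-sum bound, and Siegel's theorem): the
  cheapest refutation scenario "`λ` on `n`-bit inputs is the Jacobi symbol of a `(1−ε)n`-bit
  integer" is dead.

Theorems only.
-/

set_option linter.dupNamespace false -- D-0017: single-problem summit ⇒ `QuantumAdvantage.QuantumAdvantage` by design

namespace Summit.QuantumAdvantage.QuantumAdvantage.Theorems.LiouvilleNotPPoly

open Filter
open Summit.QuantumAdvantage.QuantumAdvantage.Theses.MobiusLadder (LiouvilleNotPPoly)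

/-- **T1 · Eventual polynomial twins put `L_λ` in `P/poly`.** -/
theorem liouville_mem_PPoly_of_eventualPolyTwins
    (h : ∃ k : ℕ, ∀ᶠ n : ℕ in atTop, ∃ d : ℤ, |d| ≤ 2 ^ n ^ k ∧
      ∀ p : ℕ, p.Prime → p ≠ 2 → p ≤ 2 ^ n → jacobiSym d p = -1) :
    Computability.encodingNatBool.toLanguage {N : ℕ | ArithmeticFunction.liouville N = -1} ∈
      Literature.Computability.Complexity.PPoly :=
  stub_twinsRefute stub_jacobiSymCodeFP stub_twoAdicSplitCodeFP h

/-- **T1 · Eventual polynomial twins refute the crux.** -/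
theorem not_liouvilleNotPPoly_of_eventualPolyTwins
    (h : ∃ k : ℕ, ∀ᶠ n : ℕ in atTop, ∃ d : ℤ, |d| ≤ 2 ^ n ^ k ∧
      ∀ p : ℕ, p.Prime → p ≠ 2 → p ≤ 2 ^ n → jacobiSym d p = -1) :
    ¬ LiouvilleNotPPoly :=
  fun hX => hX (liouville_mem_PPoly_of_eventualPolyTwins h)

/-- **T1, contrapositive · the crux's arithmetic debt**: the crux implies twin-freeness at EVERY
polynomial bit budget — for every `k`, for infinitely many `n`, every `d` with `|d| ≤ 2^{n^k}` has
an odd prime `p ≤ 2^n` at which it is not inert, `(d | p) ≠ −1`. -/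
theorem exists_nonInert_prime_of_liouvilleNotPPoly :
    Summit.QuantumAdvantage.QuantumAdvantage.Theses.MobiusLadder.LiouvilleNotPPoly → ∀ k : ℕ,
      ∃ᶠ n : ℕ in Filter.atTop, ∀ d : ℤ, |d| ≤ 2 ^ n ^ k →
        ∃ p : ℕ, p.Prime ∧ p ≠ 2 ∧ p ≤ 2 ^ n ∧ jacobiSym d p ≠ -1 := by
  intro hX k
  by_contra hnot
  rw [Filter.not_frequently] at hnot
  refine not_liouvilleNotPPoly_of_eventualPolyTwins ⟨k, hnot.mono fun n hn => ?_⟩ hX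
  obtain ⟨d, hd⟩ := not_forall.1 hn
  obtain ⟨h1, h2⟩ := Classical.not_imp.1 hd
  refine ⟨d, h1, fun p hp hp2 hpx => ?_⟩
  by_contra hJ
  exact h2 ⟨p, hp, hp2, hpx, hJ⟩

/-- **T2 · Twins are large, unconditionally**: for every `c < 1`, eventually in `n`, no `d` with
`|d| ≤ 2^{cn}` is a Liouville twin of level `2^n`. -/
theorem not_twin_of_abs_le_rpow :
    ∀ c : ℝ, c < 1 → ∀ᶠ n : ℕ in Filter.atTop, ∀ d : ℤ, (|d| : ℝ) ≤ 2 ^ (c * n) →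
      ¬ ∀ p : ℕ, p.Prime → p ≠ 2 → p ≤ 2 ^ n → jacobiSym d p = -1 :=
  stub_twinFreeSublinear stub_twinDivisorSum (fun q _ χ => stub_divisorSumHyperbola q χ)

/-- **T2, positively**: for every `c < 1`, eventually in `n`, every `d` with `|d| ≤ 2^{cn}` has an
odd prime `p ≤ 2^n` with `(d | p) ≠ −1`. -/
theorem exists_nonInert_prime_of_abs_le_rpow (c : ℝ) (hc : c < 1) :
    ∀ᶠ n : ℕ in atTop, ∀ d : ℤ, (|d| : ℝ) ≤ 2 ^ (c * n) →
      ∃ p : ℕ, p.Prime ∧ p ≠ 2 ∧ p ≤ 2 ^ n ∧ jacobiSym d p ≠ -1 := by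
  filter_upwards [not_twin_of_abs_le_rpow c hc] with n hn d hd
  have h := hn d hd
  by_contra hall
  refine h fun p hp hp2 hpx => ?_
  by_contra hJ
  exact hall ⟨p, hp, hp2, hpx, hJ⟩

end Summit.QuantumAdvantage.QuantumAdvantage.Theorems.LiouvilleNotPPoly
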